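import Summits.Parity.GeneralizedHardyLittlewood.Theses.LeeYangFibres
import Summits.Parity.GeneralizedHardyLittlewood.Theorems.LeeYangFibresCellParityLawSavingDefs
import Summits.Parity.GeneralizedHardyLittlewood.Theorems.LeeYangFibresCellParityLawSavingDensityAlong
import Summits.Parity.GeneralizedHardyLittlewood.Theorems.LeeYangFibresCellParityLawSavingWalshStep
import Summits.Parity.GeneralizedHardyLittlewood.Theorems.LeeYangFibresCellParityLawSavingBase
import Summits.Parity.GeneralizedHardyLittlewood.Theorems.LeeYangFibresCellParityLawSingularRatio
import HarnessLib

/-!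
# Route `LeeYangFibres`, crux `CellParityLawSaving` (stmt-Parity-18104), line `superpoly-band-same-atom`:
# the reduction of the crux to Bombieri's one-parameter section law along the schedule (registered stub `stub_reductionSav`)

**Theorem (sorry-free).** If for every `t ≥ 1` the coordinate sections of every non-degenerate `(t+1)`-form
one-dimensional system obey Bombieri's one-parameter parity law ALONG THE SCHEDULE `u = U(N) = slowDegree N` with a
log-power saving (`SectionLawSavAt t`, vocabulary file `LeeYangFibresCellParityLawSavingDefs`: for each section one
free `δ' ∈ [0,2]`, cells `= (1 + (δ'-1)(-1)^m) · a_m · (𝔖/𝔖₋ᵢ) · F + O(N/(log^{t+1}N (log N)^δ))` for some `δ = δ(t,L) > 0`),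
then the crux `LeeYangFibres.CellParityLawSaving` holds: `C_j = W_θ(σ(j)) · β_∞ 𝔖 ∏ A_{j_i}(N)/N + O(N/(log^t N (log N)^δ))`
at `u = U(N)`, with `θ_∅ = 1`, `|θ_S| ≤ 2`, uniformly.

Proof. Induction on the number of forms (`composeSav`) with the LANDED stubs of the line: the base `LawSavAt 1`
(`stub_baseSavInlined`, p161685: one progression segment along the schedule — Siegel–Walfisz through the explicit class
equidistribution `RoughCellsAP.exists_abs_cellClassDisc_le_pow` and the explicit local law
`RoughCellsLocal.abs_cellClass_segment_sub_le_explicit`, plus Alladi's cell asymptotics with the explicit constant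
`anatomyAlong_explicitCellRate`), the step `LawSavAt t → LawSavAt (t+1)` (`stub_walshStepSav`, p159624: tensor flattening +
Walsh inversion with positivity via `ParityWalsh.exists_walshSum_of_sections`, halving the saving), fed with the
hypothesis `SectionLawSavAt t`, the anatomy bounds along the schedule (`stub_densityAlong`, p159270, from `AnatomyAlong`)
and the sister crux's singular-series bookkeeping (`stub_singularRatio`); finally the definitional identification
`cellParityLawSaving_of_lawSavAt`.

What this isolates: along the schedule the crux is EXACTLY as hard as the one-parameter section law with a log-power
saving, i.e. as an effective Bombieri asymptotic sieve for the section sequences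
`b(m) = #{n ∈ K ∩ ℤ : ψ_i(n) = m, ψ_k(n) ∈ cell j'_k (k ≠ i)}` at roughness `N^{1/U(N)}` with relative accuracy
`(log N)^{-δ}`; the line's remaining registered stubs supply it from the atom along the schedule (`stub_atom`, the
conjectural typed tuple-GEH input) and the super-polynomial-rate kernel (`stub_kernel`) through the engine
(`stub_engineSav`). Nothing number-theoretic is assumed in this file. Schedule analogue of the sister's
`stub_reduction` (`LeeYangFibresCellParityLawReduction`).

References: E. Bombieri, *The asymptotic sieve*, Rend. Accad. Naz. XL (5) 1/2 (1975/76) 243–269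
[BombieriAsymptoticSieve1976]; B. Green, T. Tao, Ann. of Math. 171 (2010) Conj. 1.4 [GreenTao2010].
-/

noncomputable section

open scoped BigOperators Classical
open Finset Literature.NumberTheory.Sieve
open Summit.Parity.GeneralizedHardyLittlewood.Cruxes.CellParityLaw.SectionAnnihilator

namespace Summit.Parity.GeneralizedHardyLittlewood.Cruxes.CellParityLawSaving.SuperPolyBand

/-- **The base along the schedule in the vocabulary's form**: `LawSavAt 1` (the registered `stub_baseSav`) IS the
landed `stub_baseSavInlined` (p161685) — `LawSavAt 1` unfolds to its statement. -/
theorem lawSavAt_one : LawSavAt 1 := fun L => stub_baseSavInlined L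

/-- The law along the schedule for every number of forms `t ≥ 1` from the section laws along the schedule:
induction on `t` (`composeSav`) from the landed base through the landed Walsh step (with `stub_densityAlong` and
`stub_singularRatio`). -/
theorem lawSavAt_of_sectionLawSav (hSec : ∀ t : ℕ, 1 ≤ t → SectionLawSavAt t) :
    ∀ t : ℕ, 1 ≤ t → LawSavAt t :=
  composeSav stub_densityAlong stub_singularRatio stub_walshStepSav lawSavAt_one hSec

/-- **`stub_reductionSav`** (registered stub, PROVED): Bombieri's one-parameter section law along the schedule
for every number of forms implies the crux `LeeYangFibres.CellParityLawSaving` (by `lawSavAt_of_sectionLawSav` and the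
definitional identification `cellParityLawSaving_of_lawSavAt`). -/
theorem stub_reductionSav : (∀ t : ℕ, 1 ≤ t → SectionLawSavAt t) → Summit.Parity.GeneralizedHardyLittlewood.Theses.LeeYangFibres.CellParityLawSaving :=
  fun hSec => cellParityLawSaving_of_lawSavAt (lawSavAt_of_sectionLawSav hSec)

/-- Corollary in the shape of the skeleton: the crux from the kernel and the atom through ANY proof of the engine
statement `EngineSav` (the line's one open provable-or-not piece besides its two research inputs). -/
theorem cellParityLawSaving_of_engine (hEngine : EngineSav)
    (hKernel : ∃ a : ℝ, 0 < a ∧ SuperPolyRoughCellLaw a) (hAtom : ∀ t : ℕ, 1 ≤ t → SectionLevelAlong t) :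
    Summit.Parity.GeneralizedHardyLittlewood.Theses.LeeYangFibres.CellParityLawSaving :=
  stub_reductionSav (hEngine hKernel hAtom)

end Summit.Parity.GeneralizedHardyLittlewood.Cruxes.CellParityLawSaving.SuperPolyBand

end
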